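import Summits.HodgeConjecture.CorCM.MultiFieldWeilMenuAnyTypes
import HarnessLib

/-!
# MULTI-FIELD WEIL ENGINE — SIMPLE SLOTS OF ANY DEGREE: a SIMPLE CM abelian variety over a CM field `K ⊇ k` of degree `2n ≥ 4` has a type that is NOT induced from
# `k` — between `1` and `n − 1` members over `τ`; hence the sextic + octic + decic menu with «SIMPLE» on the threefold AND fourfold slots

Cell `pub-hodgecm2` (COR-CM), seat b30 gen 38 (2026-08-25); count-neutral own lane MULTI-FIELD WEIL ENGINE (stem `MultiFieldWeil*`), sequel of
`CorCM/MultiFieldWeilMenuAnyTypes.lean` (Y5: types up to complex conjugation) and of gen 31's sextic lemma `DihedralSexticPair.exists_mem_comp_ne_of_isSimple`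
(`CorCM/DihedralSexticPairCurveHodgeOfMarkmanSimple.lean`).  Theorems only; no definition, no named fact, no `sorry`.  HONEST FRAMING: conditional ONLY on the two
displayed Markman binders; `HC_CM` is NOT proved and not asserted.

§1 **`exists_mem_comp_ne_of_isSimple_of_finrank`** — `[k : ℚ] = 2`, `[K : ℚ] = 2n` with `n ≥ 2` along `i : k → K`, `(A, ι, θ)` a structure of type `(K; Φ)` with `A` SIMPLE: `Φ` has
two members with DIFFERENT restrictions to `k` (otherwise `Φ` is a whole fibre of the restriction, any two of its `n ≥ 2` members have the same `Aut(ℂ)`-pattern in `Φ`, and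
Shimura's Proposition 26 — the tree's `Literature…not_isSimple_of_isCMTypeRealisation_of_ne` — makes `A` non-simple).  The sextic proof verbatim with `3` replaced by `n`.
`card_filter_mem_pos_of_isSimple`, `card_filter_mem_lt_of_isSimple`: `0 < #{s ∈ Φ over τ} < n`; octic: `∈ {1, 2, 3}` (`card_filter_mem_octic_of_isSimple`).
§2 **`hodgeConjectureFor_biproduct_comp_of_simpleThreefolds_simpleFourfolds_weilFivefolds`** — Y5's `…simpleThreefolds_fourfolds_weilFivefolds` with the octic type
hypothesis replaced by «`B_m` SIMPLE»: `E` + SIMPLE CM threefolds over sextic fields `∋ k` + SIMPLE CM fourfolds over octic fields `∋ k` with `2`-transitive quartic part +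
CM fivefolds of `k`-signature `(2,3)` ∕ `(3,2)` over decic fields `∋ k`, under Z3's closure hypotheses ⟹ HC for every product of copies, mod Markman 4 + 6; dominated form.
(A simple CM FIVEfold may have `k`-signature `(1,4)`: not covered — no Markman input for the Weil classes of `F × E³`.)
§3 **`hodgeConjectureFor_biproduct_comp_menu_of_isSimple`** (appended) — the QUOTABLE FORM: simple threefolds ∕ simple fourfolds ∕ `(2,3)`-`(3,2)` fivefolds; `Hom = ∅` for sextic
and for decic pairs (W1 §3, Y1 §1); degree `24` for octic fields (Z4); a value outside the closure only for octic → octic ∕ sextic pairs; dominated form.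

[cite: Shimura1998, §8.2 Prop. 26 and §8.4] [cite: Deligne1982HodgeCycles, §5 (b)] [cite: Markman2025SurveySecant, Thm. 1.2] [cite: Markman2025SecantWeil, Thm 1.5.1]
[cite: Pohlmann1968, Thm 1] [cite: MoonenZarhin1995Duke, Thm. 2.4] [cite: DixonMortimer1996, §3.3, Thm. 3.3A] [cite: MumfordAV1970, §19]

## References
* [Shimura1998] G. Shimura, *Abelian varieties with complex multiplication and modular functions*, §8.2 Prop. 26, §8.4.  [Deligne1982HodgeCycles] P. Deligne (notes by
  J. S. Milne), Hodge cycles on abelian varieties, LNM 900 (1982), §5 (b).  [Markman2025SurveySecant] E. Markman, arXiv:2509.23403, Thm. 1.2.  [Markman2025SecantWeil]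
  E. Markman, Cycles on abelian 2n-folds of Weil type from secant sheaves on abelian n-folds, Thm 1.5.1.  [Pohlmann1968] H. Pohlmann, Ann. of Math. 88 (1968), Thm 1.
  [MoonenZarhin1995Duke] B. Moonen, Yu. Zarhin, Duke Math. J. 77 (1995), Thm. 2.4.  [DixonMortimer1996] J. D. Dixon, B. Mortimer, *Permutation Groups*, GTM 163, §3.3.
  [MumfordAV1970] D. Mumford, *Abelian Varieties*, §19.
-/

noncomputable section

open CategoryTheory CategoryTheory.Limits NumberField IntermediateField

namespace Summit.HodgeConjecture.CorCM.MultiFieldWeil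

open Finset
open Literature.AlgebraicGeometry Literature.AlgebraicGeometry.Motives Literature.AlgebraicGeometry.HodgeTheory
open Literature.AlgebraicGeometry.ComplexMultiplication (IsCMTypeRealisation)
open Literature.AlgebraicTopology.SingularHomology
open Literature.NumberTheory.ComplexMultiplication
open Summit.HodgeConjecture.CorCM.Census.MultiFieldWeil

open scoped Classical

/-! ## §1 A simple CM abelian variety over `K ⊇ k` has a type not induced from `k` -/

section Simple

variable {k : Type} [Field k] [NumberField k] [IsCMField k]

/-- **THE TYPE OF A SIMPLE CM ABELIAN VARIETY OVER `K ⊇ k` (`[K : k] = n ≥ 2`) IS NOT INDUCED FROM `k`**: it has two members with different restrictions to `k`.  Otherwise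
`Φ` is the whole fibre over one embedding `τ₁` of `k`; two distinct members `s ≠ t` of that fibre then have the same pattern `ρ ∘ s ∈ Φ ⟺ ρ ∘ t ∈ Φ` under every automorphism
`ρ` of `ℂ` (both sides say `ρ ∘ τ₁ = τ₁`), and Shimura's Proposition 26 makes `A` non-simple. [cite: Shimura1998, §8.2 Prop. 26 and §8.4] -/
theorem exists_mem_comp_ne_of_isSimple_of_finrank {K : Type} [Field K] [NumberField K] [IsCMField K] {nK : ℕ} (hK : Module.finrank ℚ K = 2 * nK) (hn : 2 ≤ nK)
    (h2 : Module.finrank ℚ k = 2) (i : k →+* K) {Φ : CMType K} {A : AbelianVariety ℂ} {ι : 𝓞 K →+* End A} {θ : K →+* Module.End ℂ (complexBetti A.X 1)}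
    (hA : IsCMTypeRealisation Φ A ι θ) (hS : A.IsSimple) : ∃ s ∈ Φ.1, ∃ s' ∈ Φ.1, s.comp i ≠ s'.comp i := by
  by_contra hall
  push Not at hall
  -- a member `s₀` of `Φ` and its restriction `τ₁`
  obtain ⟨a₀⟩ : Nonempty (K →+* ℂ) := inferInstance
  obtain ⟨s₀, hs₀⟩ : ∃ s, s ∈ Φ.1 := by
    by_cases h : a₀ ∈ Φ.1
    · exact ⟨a₀, h⟩
    · exact ⟨ComplexEmbedding.conjugate a₀, (Φ.2 _).2 (by rw [ComplexEmbedding.involutive_conjugate K a₀]; exact h)⟩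
  set τ₁ : k →+* ℂ := s₀.comp i with hτ₁
  have hττ : ComplexEmbedding.conjugate τ₁ ≠ τ₁ := QuarticCM.conjugate_ne τ₁
  -- `Φ` is the `τ₁`-fibre
  have hmem : ∀ u : K →+* ℂ, u ∈ Φ.1 ↔ u.comp i = τ₁ := by
    intro u
    refine ⟨fun hu => hall u hu s₀ hs₀, fun hu => ?_⟩
    by_contra hu'
    have hc : ComplexEmbedding.conjugate u ∈ Φ.1 := (Φ.2 _).2 (by rw [ComplexEmbedding.involutive_conjugate K u]; exact hu')
    have h1 := hall _ hc s₀ hs₀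
    rw [NonGaloisField.conjugate_comp, hu] at h1
    exact hττ h1
  -- two distinct members of the fibre (`n ≥ 2`) have the same `Aut(ℂ)`-pattern in `Φ`
  obtain ⟨s, hs, t, ht, hst⟩ : ∃ s ∈ (Finset.univ.filter fun s : K →+* ℂ => s.comp i = τ₁), ∃ t ∈ (Finset.univ.filter fun s : K →+* ℂ => s.comp i = τ₁), s ≠ t := by
    rw [← Finset.one_lt_card, SexticOcticWeil.card_filter_comp_eq_of_finrank i hK h2 τ₁]
    omega
  simp only [Finset.mem_filter, Finset.mem_univ, true_and] at hs ht
  refine Literature.AlgebraicGeometry.ComplexMultiplication.not_isSimple_of_isCMTypeRealisation_of_ne hA hst (fun ρ => ?_) hS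
  rw [hmem, hmem, RingHom.comp_assoc, RingHom.comp_assoc, hs, ht]

/-- **A simple structure has a member of its type over `τ`** (`0 < #{s ∈ Φ over τ}`): of the two members with different restrictions one lies over `τ`, since every restriction
is `τ` or `τ̄`. [cite: Shimura1998, §8.2 Prop. 26 and §8.4] -/
theorem card_filter_mem_pos_of_isSimple {K : Type} [Field K] [NumberField K] [IsCMField K] {nK : ℕ} (hK : Module.finrank ℚ K = 2 * nK) (hn : 2 ≤ nK)
    (h2 : Module.finrank ℚ k = 2) (i : k →+* K) {Φ : CMType K} {A : AbelianVariety ℂ} {ι : 𝓞 K →+* End A} {θ : K →+* Module.End ℂ (complexBetti A.X 1)}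
    (hA : IsCMTypeRealisation Φ A ι θ) (hS : A.IsSimple) (τ : k →+* ℂ) : 0 < (Finset.univ.filter fun s : K →+* ℂ => s.comp i = τ ∧ s ∈ Φ.1).card := by
  obtain ⟨s, hs, s', hs', hne⟩ := exists_mem_comp_ne_of_isSimple_of_finrank hK hn h2 i hA hS
  have hdich : ∀ u : K →+* ℂ, u.comp i = τ ∨ u.comp i = ComplexEmbedding.conjugate τ := fun u => QuarticCM.eq_or_eq_conjugate_of_quadratic h2 τ (u.comp i)
  refine Finset.card_pos.2 ?_
  rcases hdich s with h | h
  · exact ⟨s, Finset.mem_filter.2 ⟨Finset.mem_univ _, h, hs⟩⟩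
  · rcases hdich s' with h' | h'
    · exact ⟨s', Finset.mem_filter.2 ⟨Finset.mem_univ _, h', hs'⟩⟩
    · exact absurd (h.trans h'.symm) hne

/-- **… and misses a member of the `τ`-fibre** (`#{s ∈ Φ over τ} < n`): the conjugate of a member of `Φ` over `τ̄` lies over `τ` outside `Φ`. [cite: Shimura1998, §8.2 Prop. 26 and §8.4] -/
theorem card_filter_mem_lt_of_isSimple {K : Type} [Field K] [NumberField K] [IsCMField K] {nK : ℕ} (hK : Module.finrank ℚ K = 2 * nK) (hn : 2 ≤ nK)
    (h2 : Module.finrank ℚ k = 2) (i : k →+* K) {Φ : CMType K} {A : AbelianVariety ℂ} {ι : 𝓞 K →+* End A} {θ : K →+* Module.End ℂ (complexBetti A.X 1)}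
    (hA : IsCMTypeRealisation Φ A ι θ) (hS : A.IsSimple) (τ : k →+* ℂ) : (Finset.univ.filter fun s : K →+* ℂ => s.comp i = τ ∧ s ∈ Φ.1).card < nK := by
  have hpos := card_filter_mem_pos_of_isSimple hK hn h2 i hA hS (ComplexEmbedding.conjugate τ)
  obtain ⟨t, ht⟩ := Finset.card_pos.1 hpos
  rw [Finset.mem_filter] at ht
  -- `t̄` lies over `τ`, outside `Φ`
  have htc : (ComplexEmbedding.conjugate t).comp i = τ := by rw [NonGaloisField.conjugate_comp, ht.2.1, ComplexEmbedding.involutive_conjugate k τ]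
  have htn : ComplexEmbedding.conjugate t ∉ Φ.1 := (Φ.2 t).1 ht.2.2
  rw [← SexticOcticWeil.card_filter_comp_eq_of_finrank i hK h2 τ]
  refine Finset.card_lt_card ⟨fun u hu => ?_, fun hsub => ?_⟩
  · rw [Finset.mem_filter] at hu ⊢
    exact ⟨hu.1, hu.2.1⟩
  · have h := hsub (Finset.mem_filter.2 ⟨Finset.mem_univ _, htc⟩)
    exact htn (Finset.mem_filter.1 h).2.2

/-- **Octic fields: a simple CM fourfold over `K ⊇ k` has `1`, `2` or `3` members of its type over `τ`.** [cite: Shimura1998, §8.2 Prop. 26 and §8.4] -/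
theorem card_filter_mem_octic_of_isSimple {K : Type} [Field K] [NumberField K] [IsCMField K] (h8 : Module.finrank ℚ K = 8) (h2 : Module.finrank ℚ k = 2) (i : k →+* K)
    {Φ : CMType K} {A : AbelianVariety ℂ} {ι : 𝓞 K →+* End A} {θ : K →+* Module.End ℂ (complexBetti A.X 1)} (hA : IsCMTypeRealisation Φ A ι θ) (hS : A.IsSimple)
    (τ : k →+* ℂ) :
    (Finset.univ.filter fun s : K →+* ℂ => s.comp i = τ ∧ s ∈ Φ.1).card = 1 ∨ (Finset.univ.filter fun s : K →+* ℂ => s.comp i = τ ∧ s ∈ Φ.1).card = 2 ∨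
      (Finset.univ.filter fun s : K →+* ℂ => s.comp i = τ ∧ s ∈ Φ.1).card = 3 := by
  have h₁ := card_filter_mem_pos_of_isSimple (nK := 4) (by rw [h8]) (by norm_num) h2 i hA hS τ
  have h₂ := card_filter_mem_lt_of_isSimple (nK := 4) (by rw [h8]) (by norm_num) h2 i hA hS τ
  omega

end Simple

/-! ## §2 The menu with SIMPLE threefold and fourfold slots -/

section Headline

variable {I : Type} {r : ℕ} {Kf : I → Type} [∀ i, Field (Kf i)] [∀ i, NumberField (Kf i)] [∀ i, IsCMField (Kf i)]
  {i₀ : I} {is : Fin r → I} {τ : Kf i₀ →+* ℂ}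
  {A : Fin (r + 1) → AbelianVariety ℂ} {Φ : ∀ j : Fin (r + 1), CMType (Kf (mfSlots i₀ is j))}
  {ι : ∀ j, 𝓞 (Kf (mfSlots i₀ is j)) →+* End (A j)}
  {θ : ∀ j, Kf (mfSlots i₀ is j) →+* Module.End ℂ (complexBetti (A j).X 1)}

/-- **SIMPLE CM THREEFOLDS, SIMPLE CM FOURFOLDS (OCTIC FIELDS WITH `2`-TRANSITIVE QUARTIC PART), WEIL-TYPE CM FIVEFOLDS, ALL THROUGH `k` — GIVEN ONLY MARKMAN'S TWO
THEOREMS.**  `k = Kf i₀` imaginary quadratic, `E = A 0 ⊨ (k; {τ})`; `B_m = A (m+1) ⊨ (K_m; Φ (m+1))`, `[K_m : k] = n_m ∈ {3, 4, 5}`: for `n_m ∈ {3, 4}` the variety `B_m` is SIMPLE (no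
hypothesis on its type); for `n_m = 5` the type has `2` or `3` members over `τ`.  HYPOTHESES (Z3): (i) for octic `K_m` the automorphisms of `ℂ` over `τ(k)` are `2`-transitive on
its `τ`-embeddings (quartic part `𝔄₄` or `𝔖₄`); (ii) for `m₀ ≠ m` with `n_{m₀} = n_m`, and for `n_{m₀} = 4`, `n_m = 3`, some `τ`-embedding of `K_m` takes some value outside
`L(K_{m₀})`.  Then the Hodge conjecture holds for EVERY product of copies `⨁_j A(κ j)`.  `HC_CM` is NOT asserted. [cite: Markman2025SurveySecant, Thm. 1.2]
[cite: Markman2025SecantWeil, Thm 1.5.1] [cite: Shimura1998, §8.2 Prop. 26 and §8.4] [cite: Deligne1982HodgeCycles, §5 (b)] [cite: DixonMortimer1996, §3.3, Thm. 3.3A] -/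
theorem hodgeConjectureFor_biproduct_comp_of_simpleThreefolds_simpleFourfolds_weilFivefolds (hW4 : Markman2025_weilClasses_algebraic_abelianFourfold)
    (hM6 : Markman2025_weilClasses_algebraic_hyperbolicSixfold) (n : Fin r → ℕ) (hn : ∀ m, n m = 3 ∨ n m = 4 ∨ n m = 5)
    {N : ℕ} (κ : Fin N → Fin (r + 1)) (h2 : Module.finrank ℚ (Kf i₀) = 2) (hdeg : ∀ m : Fin r, Module.finrank ℚ (Kf (is m)) = 2 * n m)
    (im : ∀ m : Fin r, Kf i₀ →+* Kf (is m)) (hA : ∀ j, IsCMTypeRealisation (Φ j) (A j) (ι j) (θ j)) (hΨ : ∀ σ : Kf i₀ →+* ℂ, σ ∈ (Φ 0).1 ↔ σ = τ)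
    (hS : ∀ m : Fin r, n m = 3 ∨ n m = 4 → (A m.succ).IsSimple)
    (h23 : ∀ m : Fin r, n m = 5 → (Finset.univ.filter fun s : Kf (is m) →+* ℂ => s.comp (im m) = τ ∧ s ∈ (Φ m.succ).1).card = 2 ∨
      (Finset.univ.filter fun s : Kf (is m) →+* ℂ => s.comp (im m) = τ ∧ s ∈ (Φ m.succ).1).card = 3)
    (h2T : ∀ m : Fin r, n m = 4 → ∀ s₁ s₂ s₁' s₂' : Kf (is m) →+* ℂ, s₁.comp (im m) = τ → s₂.comp (im m) = τ → s₁'.comp (im m) = τ →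
      s₂'.comp (im m) = τ → s₁ ≠ s₂ → s₁' ≠ s₂' → ∃ ρ : ℂ ≃+* ℂ, (ρ : ℂ →+* ℂ).comp τ = τ ∧ (ρ : ℂ →+* ℂ).comp s₁ = s₁' ∧ (ρ : ℂ →+* ℂ).comp s₂ = s₂')
    (hout : ∀ (m₀ m : Fin r), m₀ ≠ m → (n m₀ = n m ∨ (n m₀ = 4 ∧ n m = 3)) →
      ∃ s : Kf (is m) →+* ℂ, s.comp (im m) = τ ∧ ∃ x, s x ∉ normalClosure ℚ (Kf (is m₀)) ℂ) :
    HodgeConjectureFor (⨁ fun j => A (κ j)).dim (⨁ fun j => A (κ j)).X :=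
  hodgeConjectureFor_biproduct_comp_of_simpleThreefolds_fourfolds_weilFivefolds hW4 hM6 n hn κ h2 hdeg im hA hΨ (fun m h3 => hS m (Or.inl h3))
    (fun m h4 => card_filter_mem_octic_of_isSimple (by rw [hdeg m, h4]) h2 (im m) (hA m.succ) (hS m (Or.inr h4)) τ) h23 h2T hout

/-- **Dominated form.** [cite: Markman2025SurveySecant, Thm. 1.2] [cite: Markman2025SecantWeil, Thm 1.5.1] [cite: MumfordAV1970, §19] -/
theorem hodgeConjectureFor_of_avDominatedBy_comp_of_simpleThreefolds_simpleFourfolds_weilFivefolds (hW4 : Markman2025_weilClasses_algebraic_abelianFourfold)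
    (hM6 : Markman2025_weilClasses_algebraic_hyperbolicSixfold) (n : Fin r → ℕ) (hn : ∀ m, n m = 3 ∨ n m = 4 ∨ n m = 5)
    {N : ℕ} (κ : Fin N → Fin (r + 1)) (h2 : Module.finrank ℚ (Kf i₀) = 2) (hdeg : ∀ m : Fin r, Module.finrank ℚ (Kf (is m)) = 2 * n m)
    (im : ∀ m : Fin r, Kf i₀ →+* Kf (is m)) (hA : ∀ j, IsCMTypeRealisation (Φ j) (A j) (ι j) (θ j)) (hΨ : ∀ σ : Kf i₀ →+* ℂ, σ ∈ (Φ 0).1 ↔ σ = τ)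
    (hS : ∀ m : Fin r, n m = 3 ∨ n m = 4 → (A m.succ).IsSimple)
    (h23 : ∀ m : Fin r, n m = 5 → (Finset.univ.filter fun s : Kf (is m) →+* ℂ => s.comp (im m) = τ ∧ s ∈ (Φ m.succ).1).card = 2 ∨
      (Finset.univ.filter fun s : Kf (is m) →+* ℂ => s.comp (im m) = τ ∧ s ∈ (Φ m.succ).1).card = 3)
    (h2T : ∀ m : Fin r, n m = 4 → ∀ s₁ s₂ s₁' s₂' : Kf (is m) →+* ℂ, s₁.comp (im m) = τ → s₂.comp (im m) = τ → s₁'.comp (im m) = τ →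
      s₂'.comp (im m) = τ → s₁ ≠ s₂ → s₁' ≠ s₂' → ∃ ρ : ℂ ≃+* ℂ, (ρ : ℂ →+* ℂ).comp τ = τ ∧ (ρ : ℂ →+* ℂ).comp s₁ = s₁' ∧ (ρ : ℂ →+* ℂ).comp s₂ = s₂')
    (hout : ∀ (m₀ m : Fin r), m₀ ≠ m → (n m₀ = n m ∨ (n m₀ = 4 ∧ n m = 3)) →
      ∃ s : Kf (is m) →+* ℂ, s.comp (im m) = τ ∧ ∃ x, s x ∉ normalClosure ℚ (Kf (is m₀)) ℂ)
    {X : AbelianVariety ℂ} (hX : Domination.AVDominatedBy X (⨁ fun j => A (κ j))) : HodgeConjectureFor X.dim X.X :=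
  Domination.hodgeConjectureFor_of_avDominatedBy
    (hodgeConjectureFor_biproduct_comp_of_simpleThreefolds_simpleFourfolds_weilFivefolds hW4 hM6 n hn κ h2 hdeg im hA hΨ hS h23 h2T hout) hX

/-! ## §3 The quotable form: simple factors, `Hom = ∅`, degree `24` -/

/-- **THE MENU, QUOTABLE FORM — GIVEN ONLY MARKMAN'S FOURFOLD AND HYPERBOLIC-SIXFOLD THEOREMS.**  `k = Kf i₀` an imaginary quadratic field, `E = A 0 ⊨ (k; {τ})` its CM elliptic
curve; `B_m = A (m+1) ⊨ (K_m; Φ (m+1))` CM abelian varieties over CM fields `K_m ⊇ i_m(k)` with `[K_m : k] = n_m ∈ {3, 4, 5}` such that: `B_m` is SIMPLE when `n_m ∈ {3, 4}`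
(simple CM threefolds, simple CM fourfolds); the type of `B_m` has `2` or `3` members over `τ` when `n_m = 5` (CM fivefolds of `k`-signature `(2,3)` ∕ `(3,2)`); for every OCTIC
`K_m` two distinct `τ`-embeddings `s₀, t₀` have `[ℚ(τk)·s₀(K_m)·t₀(K_m) : ℚ] = 24` (quartic part `𝔄₄` or `𝔖₄`); for `m₀ ≠ m` both sextic or both decic `Hom(K_m, K_{m₀}) = ∅`
(pairwise non-isomorphic); for `m₀ ≠ m` with `K_{m₀}` OCTIC and `K_m` octic or sextic, some `τ`-embedding of `K_m` takes some value outside the Galois closure of `K_{m₀}` in `ℂ`.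
Then the Hodge conjecture holds for EVERY product of copies `⨁_j A(κ j)` — `E^a × ∏_m B_m^{b_m}`, any exponents, any order.  `HC_CM` is NOT asserted.
[cite: Markman2025SurveySecant, Thm. 1.2] [cite: Markman2025SecantWeil, Thm 1.5.1] [cite: Shimura1998, §8.2 Prop. 26 and §8.4] [cite: Deligne1982HodgeCycles, §5 (b)]
[cite: Dodson1984, §1.1 Imprimitivity Theorem and §5.1.2 Theorem] [cite: DixonMortimer1996, §1.6, Thm. 1.6A; §3.3, Thm. 3.3A] [cite: Lang2002, I §5 Thm. 5.5, VI §1 Thm. 1.1] -/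
theorem hodgeConjectureFor_biproduct_comp_menu_of_isSimple (hW4 : Markman2025_weilClasses_algebraic_abelianFourfold)
    (hM6 : Markman2025_weilClasses_algebraic_hyperbolicSixfold) (n : Fin r → ℕ) (hn : ∀ m, n m = 3 ∨ n m = 4 ∨ n m = 5)
    {N : ℕ} (κ : Fin N → Fin (r + 1)) (h2 : Module.finrank ℚ (Kf i₀) = 2) (hdeg : ∀ m : Fin r, Module.finrank ℚ (Kf (is m)) = 2 * n m)
    (im : ∀ m : Fin r, Kf i₀ →+* Kf (is m)) (hA : ∀ j, IsCMTypeRealisation (Φ j) (A j) (ι j) (θ j)) (hΨ : ∀ σ : Kf i₀ →+* ℂ, σ ∈ (Φ 0).1 ↔ σ = τ)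
    (hS : ∀ m : Fin r, n m = 3 ∨ n m = 4 → (A m.succ).IsSimple)
    (h23 : ∀ m : Fin r, n m = 5 → (Finset.univ.filter fun s : Kf (is m) →+* ℂ => s.comp (im m) = τ ∧ s ∈ (Φ m.succ).1).card = 2 ∨
      (Finset.univ.filter fun s : Kf (is m) →+* ℂ => s.comp (im m) = τ ∧ s ∈ (Φ m.succ).1).card = 3)
    (h24 : ∀ m : Fin r, n m = 4 → ∃ s₀ t₀ : Kf (is m) →+* ℂ, s₀.comp (im m) = τ ∧ t₀.comp (im m) = τ ∧ s₀ ≠ t₀ ∧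
      Module.finrank ℚ ↥(adjoin ℚ (Set.range τ) ⊔ adjoin ℚ (Set.range s₀ ∪ Set.range t₀)) = 24)
    (hiso : ∀ (m₀ m : Fin r), m₀ ≠ m → n m₀ = n m → (n m = 3 ∨ n m = 5) → IsEmpty (Kf (is m) →+* Kf (is m₀)))
    (hout4 : ∀ (m₀ m : Fin r), m₀ ≠ m → n m₀ = 4 → (n m = 4 ∨ n m = 3) →
      ∃ s : Kf (is m) →+* ℂ, s.comp (im m) = τ ∧ ∃ x, s x ∉ normalClosure ℚ (Kf (is m₀)) ℂ) :
    HodgeConjectureFor (⨁ fun j => A (κ j)).dim (⨁ fun j => A (κ j)).X := by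
  refine hodgeConjectureFor_biproduct_comp_of_simpleThreefolds_simpleFourfolds_weilFivefolds hW4 hM6 n hn κ h2 hdeg im hA hΨ hS h23
    (fun m h4 => h2T_of_finrank_pair_octic h2 im hdeg h24 m h4) fun m₀ m hm hnm => ?_
  -- a `τ`-embedding of `K_m`
  have hc := SexticOcticWeil.card_filter_comp_eq_of_finrank (n := n m) (im m) (hdeg m) h2 τ
  obtain ⟨s, hs⟩ := Finset.card_pos.1 (by rw [hc]; rcases hn m with h | h | h <;> rw [h] <;> norm_num)
  have hs' : s.comp (im m) = τ := (Finset.mem_filter.1 hs).2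
  rcases hnm with heq | ⟨h4₀, h3⟩
  · rcases hn m with h3 | h4 | h5
    · exact ⟨s, hs', exists_apply_not_mem_normalClosure_of_isEmpty_ringHom h2 im (by rw [hdeg m₀, heq, h3]) (by rw [hdeg m, h3])
        (hiso m₀ m hm heq (Or.inl h3)) s hs'⟩
    · exact hout4 m₀ m hm (heq.trans h4) (Or.inl h4)
    · exact ⟨s, hs', exists_apply_not_mem_normalClosure_of_isEmpty_ringHom_five h2 im (by rw [hdeg m₀, heq, h5]) (by rw [hdeg m, h5])
        (hiso m₀ m hm heq (Or.inr h5)) s hs'⟩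
  · exact hout4 m₀ m hm h4₀ (Or.inr h3)

/-- **Dominated form of the quotable form**: every complex abelian variety dominated by such a product of copies satisfies the Hodge conjecture, GIVEN ONLY Markman's two theorems.
`HC_CM` is NOT asserted. [cite: Markman2025SurveySecant, Thm. 1.2] [cite: Markman2025SecantWeil, Thm 1.5.1] [cite: MumfordAV1970, §19] -/
theorem hodgeConjectureFor_of_avDominatedBy_comp_menu_of_isSimple (hW4 : Markman2025_weilClasses_algebraic_abelianFourfold)
    (hM6 : Markman2025_weilClasses_algebraic_hyperbolicSixfold) (n : Fin r → ℕ) (hn : ∀ m, n m = 3 ∨ n m = 4 ∨ n m = 5)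
    {N : ℕ} (κ : Fin N → Fin (r + 1)) (h2 : Module.finrank ℚ (Kf i₀) = 2) (hdeg : ∀ m : Fin r, Module.finrank ℚ (Kf (is m)) = 2 * n m)
    (im : ∀ m : Fin r, Kf i₀ →+* Kf (is m)) (hA : ∀ j, IsCMTypeRealisation (Φ j) (A j) (ι j) (θ j)) (hΨ : ∀ σ : Kf i₀ →+* ℂ, σ ∈ (Φ 0).1 ↔ σ = τ)
    (hS : ∀ m : Fin r, n m = 3 ∨ n m = 4 → (A m.succ).IsSimple)
    (h23 : ∀ m : Fin r, n m = 5 → (Finset.univ.filter fun s : Kf (is m) →+* ℂ => s.comp (im m) = τ ∧ s ∈ (Φ m.succ).1).card = 2 ∨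
      (Finset.univ.filter fun s : Kf (is m) →+* ℂ => s.comp (im m) = τ ∧ s ∈ (Φ m.succ).1).card = 3)
    (h24 : ∀ m : Fin r, n m = 4 → ∃ s₀ t₀ : Kf (is m) →+* ℂ, s₀.comp (im m) = τ ∧ t₀.comp (im m) = τ ∧ s₀ ≠ t₀ ∧
      Module.finrank ℚ ↥(adjoin ℚ (Set.range τ) ⊔ adjoin ℚ (Set.range s₀ ∪ Set.range t₀)) = 24)
    (hiso : ∀ (m₀ m : Fin r), m₀ ≠ m → n m₀ = n m → (n m = 3 ∨ n m = 5) → IsEmpty (Kf (is m) →+* Kf (is m₀)))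
    (hout4 : ∀ (m₀ m : Fin r), m₀ ≠ m → n m₀ = 4 → (n m = 4 ∨ n m = 3) →
      ∃ s : Kf (is m) →+* ℂ, s.comp (im m) = τ ∧ ∃ x, s x ∉ normalClosure ℚ (Kf (is m₀)) ℂ)
    {X : AbelianVariety ℂ} (hX : Domination.AVDominatedBy X (⨁ fun j => A (κ j))) : HodgeConjectureFor X.dim X.X :=
  Domination.hodgeConjectureFor_of_avDominatedBy
    (hodgeConjectureFor_biproduct_comp_menu_of_isSimple hW4 hM6 n hn κ h2 hdeg im hA hΨ hS h23 h24 hiso hout4) hX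

end Headline

end Summit.HodgeConjecture.CorCM.MultiFieldWeil

end
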